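import Summits.BirchSwinnertonDyer.BirchSwinnertonDyer.Theorems.PrintCFramBottomClassIndexLawFiveLeHerbrandUntwist
import Summits.BirchSwinnertonDyer.BirchSwinnertonDyer.Theorems.PrintCFramBottomClassIndexLawFiveLeHerbrandBadPlacesSign
import HarnessLib

/-!
# Route `PrintCFram`, crux C2 `BottomClassIndexLawFiveLe` (stmt-BirchSwinnertonDyer-20372), line `eisenstein-resource-bdp-line`
# (registry v10), Stub H: UNTWISTING WITH THE BAD SET ERASED — Stub H's two conclusions (at the bad set `S` of the statement, or
# any `S` inside it) ⟸ the untwisted Γ_{K''}-invariant-class statements over the splitting fields WITH `S₀ = ∅`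

Cell `bsd-print-cfram`, width seat `bsd-line-cfram-p1-w7` (g0); helper `--supports stmt-BirchSwinnertonDyer-20372`; the composition
BY NAME of LEAD g8's T4 step A1 `HerbrandUntwist.stubH_of_untwisted_of_cmRamified` (p650708) with this seat's S-invisibility
`BadPlacesSign.datumStrictSelmer_layerZero_badSet_eq_empty_of_cmRamified` (p650489). THEOREMS ONLY (0 definitions, 0 named facts,
0 instances, no `sorry`). HONEST FRAMING: nothing about BSD is proved; no stub is closed; BSD is not proved by any of this; no summit
statement is proved by this seat.

## What

* `datumStrictSelmer_layerZero_eq_empty_of_subset_badSet` — on the CM-ramified class (W CM, `CMRamified W p`, `5 ≤ p`, ANY number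
  field `K`, any `κ`, any stable `Φ ≤ W_K[p]`, any data): for EVERY `S ⊆ {v : W_K bad at v ∧ v ∤ p}` both bottom-layer groups equal the
  `S₀ = ∅` groups (sandwich `R^∅ ≤ R^S ≤ R^{S_bad} = R^∅`, GV monotonicity `datumStrictSelmer_mono` + p650489).
* **`stubH_of_untwisted_empty_of_cmRamified`** — for `W` as above, `K` quadratic (Stub H: the Heegner field), `κ`, `𝔭`, any
  `S ⊆ S_bad`, any stable `Φ` of order `p`: IF every `Γ_K`-invariant class of
  `datumStrictSelmer N_S Φ.Sub p (bdpData Φ.Sub p 𝔭) ∅` vanishes (`N_S = ker(Γ_K → Aut Φ.Sub)`; i.e. over the splitting field: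
  UNRAMIFIED AT EVERY PLACE `w ∤ p`, split at `𝔭`, free at `𝔭̄`) and likewise for `Φ.Quot`, THEN both conclusions of Stub H hold at `S`.
  So ROAD A's modulus (LEAD g8 report §4, A3/A5) is supported on `{w ∣ 𝔭̄}` only.

References: [GreenbergVatsal2000] §2 pp. 15–17, 20, 23, 28; [GreenbergLNM1716] §3; [SerreGaloisCohomology1997] I §2.6 (b).
-/

set_option autoImplicit false
-- the summit namespace `Summit.BirchSwinnertonDyer.BirchSwinnertonDyer` repeats the problem name by design (D-0017)
set_option linter.dupNamespace false

noncomputable section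

open scoped Classical

namespace Summit.BirchSwinnertonDyer.BirchSwinnertonDyer.Theorems.PrintCFram.UntwistBadSetErased

open NumberField Field IsDedekindDomain
  Literature.NumberTheory.EllipticCurves Literature.NumberTheory.EllipticCurves.GreenbergSelmer
  Literature.NumberTheory.EllipticCurves.GreenbergVatsal2000
  Literature.NumberTheory.EllipticCurves.Rank1Residual
  Literature.NumberTheory.GaloisRepresentations
  Summit.BirchSwinnertonDyer.Rank1Residual

variable {K : Type} [Field K] [NumberField K] {p : ℕ} [Fact p.Prime]

/-- **Every `S` inside the bad set is erasable.** For `W/ℚ` elliptic with CM, `p ≥ 5` CM-ramified, ANY number field `K`, any `κ`, any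
`Γ_K`-stable `Φ ≤ W_K[p]`, all data `L`, `L'`, and every `S ⊆ {v : ¬ W_K good at v ∧ v ∤ p}`: `R^S(K, Φ) = R^∅(K, Φ)` and
`R^S(K, W_K[p]/Φ) = R^∅(K, W_K[p]/Φ)` at the bottom layer (`R^∅ ≤ R^S ≤ R^{S_bad} = R^∅`).
[cite: GreenbergVatsal2000, §2 pp. 15–17, 20, 23] -/
theorem datumStrictSelmer_layerZero_eq_empty_of_subset_badSet (W : WeierstrassCurve ℚ) [W.IsElliptic]
    (hCM : W.HasCM) (hram : CMRamified W p) (h5 : 5 ≤ p) (κ : ZpExtension K p)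
    (Φ : X2.ResidualDevissageModules.StableSubgroup (absoluteGaloisGroup K) ((W.baseChange K).geomTorsion (p : ℤ)))
    (L : Data K Φ.Sub p) (L' : Data K Φ.Quot p) {S : Set (HeightOneSpectrum (𝓞 K))}
    (hS : S ⊆ {v : HeightOneSpectrum (𝓞 K) | ¬ (W.baseChange K).HasGoodReductionAt v ∧ ((p : ℕ) : 𝓞 K) ∉ v.asIdeal}) :
    datumStrictSelmer (κ.layerSubgroup 0) Φ.Sub p L S = datumStrictSelmer (κ.layerSubgroup 0) Φ.Sub p L ∅ ∧
    datumStrictSelmer (κ.layerSubgroup 0) Φ.Quot p L' S = datumStrictSelmer (κ.layerSubgroup 0) Φ.Quot p L' ∅ := by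
  obtain ⟨hSub, hQuot⟩ := BadPlacesSign.datumStrictSelmer_layerZero_badSet_eq_empty_of_cmRamified W hCM hram h5 κ Φ L L'
  refine ⟨le_antisymm ?_ (datumStrictSelmer_mono _ _ p L (Set.empty_subset S)),
    le_antisymm ?_ (datumStrictSelmer_mono _ _ p L' (Set.empty_subset S))⟩
  · exact (datumStrictSelmer_mono _ _ p L hS).trans hSub.le
  · exact (datumStrictSelmer_mono _ _ p L' hS).trans hQuot.le

/-- **Stub H ⟸ the UNTWISTED statements WITH `S₀ = ∅`** (LEAD g8's `HerbrandUntwist.stubH_of_untwisted_of_cmRamified`, p650708, composed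
with the S-erasure p650489). For `W/ℚ` elliptic with CM, `p ≥ 5` CM-ramified, `K` quadratic, any `ℤ_p`-extension `κ`, any prime `𝔭`, any
`S` contained in the bad set `{v : ¬ W_K good at v ∧ v ∤ p}` (e.g. Stub H's `S` itself), and a `Γ_K`-stable `Φ ≤ W_K[p]` of order `p` with
splitting groups `N_S = ker(Γ_K → Aut Φ)`, `N_Q = ker(Γ_K → Aut(W_K[p]/Φ))`: if every `Γ_K`-invariant class of
`datumStrictSelmer N_S Φ.Sub p (bdpData Φ.Sub p 𝔭) ∅` is zero — «over the splitting field: unramified at EVERY `w ∤ p`, split at `𝔭`, free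
at `𝔭̄`» — and likewise for `Φ.Quot`, then BOTH bottom-layer residual Selmer groups of Stub H vanish at `S`.
[cite: GreenbergLNM1716, §3 (PDF p. 86)] [cite: SerreGaloisCohomology1997, I.§2.6 (b)] [cite: GreenbergVatsal2000, §2 pp. 20, 28] -/
theorem stubH_of_untwisted_empty_of_cmRamified (W : WeierstrassCurve ℚ) [W.IsElliptic] (hCM : W.HasCM)
    (hram : CMRamified W p) (h5 : 5 ≤ p) (hK2 : Module.finrank ℚ K = 2)
    (κ : ZpExtension K p) (𝔭 : HeightOneSpectrum (𝓞 K)) {S : Set (HeightOneSpectrum (𝓞 K))}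
    (hSbad : S ⊆ {v : HeightOneSpectrum (𝓞 K) | ¬ (W.baseChange K).HasGoodReductionAt v ∧ ((p : ℕ) : 𝓞 K) ∉ v.asIdeal})
    (Φ : X2.ResidualDevissageModules.StableSubgroup (absoluteGaloisGroup K) ((W.baseChange K).geomTorsion (p : ℤ)))
    (hcard : Nat.card Φ.Sub = p)
    (hS : ∀ x ∈ datumStrictSelmer (MulAction.toPermHom (absoluteGaloisGroup K) Φ.Sub).ker Φ.Sub p
        (X11b.AcSelmer.bdpData Φ.Sub p 𝔭) ∅,
      (∀ g : absoluteGaloisGroup K, conjH1 (MulAction.toPermHom (absoluteGaloisGroup K) Φ.Sub).ker Φ.Sub g x = x) → x = 0)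
    (hQ : ∀ y ∈ datumStrictSelmer (MulAction.toPermHom (absoluteGaloisGroup K) Φ.Quot).ker Φ.Quot p
        (X11b.AcSelmer.bdpData Φ.Quot p 𝔭) ∅,
      (∀ g : absoluteGaloisGroup K, conjH1 (MulAction.toPermHom (absoluteGaloisGroup K) Φ.Quot).ker Φ.Quot g y = y) → y = 0) :
    datumStrictSelmer (κ.layerSubgroup 0) Φ.Sub p (X11b.AcSelmer.bdpData Φ.Sub p 𝔭) S = ⊥ ∧
      datumStrictSelmer (κ.layerSubgroup 0) Φ.Quot p (X11b.AcSelmer.bdpData Φ.Quot p 𝔭) S = ⊥ := by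
  obtain ⟨h1, h2⟩ := HerbrandUntwist.stubH_of_untwisted_of_cmRamified W hCM hram h5 K hK2 κ 𝔭 ∅ Φ hcard hS hQ
  obtain ⟨e1, e2⟩ := datumStrictSelmer_layerZero_eq_empty_of_subset_badSet W hCM hram h5 κ Φ
    (X11b.AcSelmer.bdpData Φ.Sub p 𝔭) (X11b.AcSelmer.bdpData Φ.Quot p 𝔭) hSbad
  exact ⟨e1.trans h1, e2.trans h2⟩

end Summit.BirchSwinnertonDyer.BirchSwinnertonDyer.Theorems.PrintCFram.UntwistBadSetErased

end
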